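import Mathlib.Topology.MetricSpace.ProperSpace.Lemmas
import Mathlib.Topology.Algebra.ConstMulAction
import Mathlib.Analysis.Convex.PathConnected
import Literature.Probability.LatticeModels.PlanarIsingOnePoint
import Literature.Probability.LatticeModels.PlanarIsingSlitDisc
import HarnessLib

/-!
# The unit disc satisfies CHI's approximation hypothesis `MeshApproximates`

`Literature.Probability.LatticeModels.MeshApproximates Ω` (`PlanarIsingOnePoint.lean`) is the
standing hypothesis of Chelkak–Hongler–Izyurov (*Conformal invariance of spin correlations in the
planar Ising model*, Ann. of Math. 181 (2015) = arXiv:1202.2838 (CHI), §2, p. 13: "we say that a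
family of discrete domains `(Ω_δ)` approximates `Ω` if `∂Ω_δ` converges to `∂Ω` in the Hausdorff
sense"; §2.1: discrete domains are unions of grid faces, "simply connected if the corresponding
polygonal domain is simply connected") specialised to the tree's fixed discretisation scheme
`meshInteriorFinset Ω δ` of `DomainDiscretisation.lean`/`PlanarIsing.lean`. It is the hypothesis
that the refuted fact `chi_halfplane_onePoint` omits and that the corrected fact
`Literature.Probability.LatticeModels.chi_halfplane_onePoint_hausdorff` carries. This file proves
that the hypothesis is **satisfiable**, indeed satisfied by the basic example:

* `meshApproximates_ball : MeshApproximates (Metric.ball 0 1)`.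

Hence `chi_halfplane_onePoint_hausdorff` is not vacuous in its domain hypotheses: together with
`SlitDisc.isAdmissibleDomain_ball` and the inverse Cayley transform
(`SlitDisc.isConformalBijection_cayleyInvFun`) it pins the one-point function of the critical
Ising model in the discretised unit disc (`chiPlusCorr_ball_of_hausdorff`).

## The argument (elementary lattice geometry; [folklore])

For `0 < δ` the free sites of the disc are exactly the sites `x ∈ ℤ²` with `δx ∈ 𝔻` whose four
`ℤ²`-neighbours also lie in `𝔻` (`UnitDisc.mem_meshInteriorFinset_iff`; the mesh vertex graph of
the disc is connected by monotone lattice paths to the origin, so `𝔻_δ` is all of `𝔻 ∩ δℤ²`, and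
two neighbouring sites of `𝔻` are always joined, the closed disc being convex — the argument of
`SupercriticalSAW.meshDomain_unitDisk` in `Literature/Barriers/CriticalPhenomena/`, re-proved here
for `Metric.ball 0 1` rather than importing the SAW barrier files into the Ising development). This set of sites
is an order ideal for the coordinatewise order on `|x₀|, |x₁|` (`UnitDisc.free_of_abs_le`), so the
union `U_δ` of their closed faces is star-shaped about `0` (`starConvex_biUnion_meshCell`, via the
rounding lemma `exists_int_abs_le_and_abs_sub_le`), hence so is its interior, the polygonal domain
`P_δ = meshInteriorPolygon 𝔻 δ`, which is therefore simply connected (`starConvex_interior`,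
`UnitDisc.isSimplyConnected_meshInteriorPolygon`, stated for `δ < 2/5`). Metric control:
every face of a free site lies in `𝔻`, and every point `z` with `‖z‖ ≤ 1 - 5δ/2` lies in `P_δ`
(the face of the site nearest to any `w ∈ B(z, δ/2)` is free), so `∂P_δ` lies in the annulus
`1 - 5δ/2 < ‖z‖ < 1`, every compact `K ⊆ 𝔻` is eventually inside `P_δ`, and every point of the
unit circle is within `5δ/2` of `∂P_δ` (the radius towards it leaves `P_δ`); thus
`hausdorffDist (∂P_δ) (∂𝔻) ≤ 5δ/2 → 0`.

## References

* D. Chelkak, C. Hongler, K. Izyurov, Ann. of Math. (2) 181 (2015), 1087–1138; arXiv:1202.2838,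
  §2 (p. 13) and §2.1 (discrete domains, Hausdorff approximation).
-/

noncomputable section

open Filter Topology Metric Set
open scoped Pointwise
open Literature.Probability.LatticeModels

namespace Literature.Probability.LatticeModels

/-! ### Rounding, cells and star-shaped unions of cells -/

/-- Rounding inside a symmetric window: if `|u| ≤ k + 1/2` for an integer `k ≥ 0`, some integer
`m` with `|m| ≤ k` is within `1/2` of `u` (take `round u` clamped to `[-k, k]`). [folklore] -/
theorem exists_int_abs_le_and_abs_sub_le {k : ℤ} (hk : 0 ≤ k) {u : ℝ} (hu : |u| ≤ k + 1 / 2) :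
    ∃ m : ℤ, |m| ≤ k ∧ |u - m| ≤ 1 / 2 := by
  have hr := abs_le.1 (abs_sub_round u)
  obtain ⟨hu₁, hu₂⟩ := abs_le.1 hu
  by_cases h₁ : k < round u
  · refine ⟨k, by rw [abs_of_nonneg hk], ?_⟩
    have h₁' : (k : ℝ) + 1 ≤ (round u : ℝ) := by exact_mod_cast Int.add_one_le_iff.2 h₁
    rw [abs_le]; constructor <;> linarith [hr.1, hr.2]
  by_cases h₂ : round u < -k
  · refine ⟨-k, by rw [abs_neg, abs_of_nonneg hk], ?_⟩
    have h₂' : (round u : ℝ) + 1 ≤ -(k : ℝ) := by exact_mod_cast Int.add_one_le_iff.2 h₂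
    rw [abs_le]; push_cast; constructor <;> linarith [hr.1, hr.2]
  · push Not at h₁ h₂
    exact ⟨round u, abs_le.2 ⟨h₂, h₁⟩, abs_sub_round u⟩

/-- Membership in a mesh cell, unfolded. [folklore] -/
theorem mem_meshCell_iff {δ : ℝ} {x : Site 2} {z : ℂ} :
    z ∈ meshCell δ x ↔ |z.re - δ * x 0| ≤ δ / 2 ∧ |z.im - δ * x 1| ≤ δ / 2 := Iff.rfl

/-- Mesh cells are closed. [folklore] -/
theorem isClosed_meshCell (δ : ℝ) (x : Site 2) : IsClosed (meshCell δ x) :=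
  (isClosed_le (continuous_abs.comp (Complex.continuous_re.sub continuous_const)) continuous_const).inter
    (isClosed_le (continuous_abs.comp (Complex.continuous_im.sub continuous_const)) continuous_const)

/-- Every point lies in the cell of its nearest site (for `δ > 0`). [folklore] -/
theorem mem_meshCell_nearestSite {δ : ℝ} (hδ : 0 < δ) (w : ℂ) : w ∈ meshCell δ (nearestSite δ w) := by
  have key : ∀ c : ℝ, |c - δ * (round (c / δ) : ℤ)| ≤ δ / 2 := fun c => by
    have h := abs_sub_round (c / δ)
    have : c - δ * (round (c / δ) : ℤ) = δ * (c / δ - round (c / δ)) := by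
      rw [mul_sub, mul_div_cancel₀ c hδ.ne']
    rw [this, abs_mul, abs_of_pos hδ]
    calc δ * |c / δ - round (c / δ)| ≤ δ * (1 / 2) := mul_le_mul_of_nonneg_left h hδ.le
      _ = δ / 2 := by ring
  refine mem_meshCell_iff.2 ⟨?_, ?_⟩
  · simpa [nearestSite] using key w.re
  · simpa [nearestSite] using key w.im

/-- **Star-shaped unions of cells.** If a set of sites `Λ` is an order ideal for the coordinatewise
order on absolute values (`x ∈ Λ`, `|x'ⱼ| ≤ |xⱼ|` for `j = 0, 1` ⇒ `x' ∈ Λ`), then the union of the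
closed cells of `Λ` is star-shaped about the origin: the shadow of a cell towards `0` is covered by
cells of sites with smaller coordinates. [folklore] -/
theorem starConvex_biUnion_meshCell {Λ : Set (Site 2)} {δ : ℝ} (hδ : 0 < δ)
    (hΛ : ∀ x ∈ Λ, ∀ x' : Site 2, (∀ j, |x' j| ≤ |x j|) → x' ∈ Λ) :
    StarConvex ℝ (0 : ℂ) (⋃ x ∈ Λ, meshCell δ x) := by
  rw [starConvex_zero_iff]
  intro z hz a ha₀ ha₁
  simp only [mem_iUnion, exists_prop] at hz ⊢
  obtain ⟨x, hx, hz⟩ := hz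
  obtain ⟨hzre, hzim⟩ := mem_meshCell_iff.1 hz
  -- one coordinate at a time
  have key : ∀ (c : ℝ) (n : ℤ), |c - δ * n| ≤ δ / 2 →
      ∃ m : ℤ, |m| ≤ |n| ∧ |a * c - δ * m| ≤ δ / 2 := by
    intro c n hc
    have h1 : |c| ≤ δ * |(n : ℝ)| + δ / 2 := by
      calc |c| = |(c - δ * n) + δ * n| := by ring_nf
        _ ≤ |c - δ * n| + |δ * (n : ℝ)| := abs_add_le _ _
        _ ≤ δ / 2 + δ * |(n : ℝ)| := by rw [abs_mul, abs_of_pos hδ]; linarith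
        _ = δ * |(n : ℝ)| + δ / 2 := by ring
    have hu : |a * c / δ| ≤ ((|n| : ℤ) : ℝ) + 1 / 2 := by
      rw [abs_div, abs_of_pos hδ, div_le_iff₀ hδ, abs_mul, abs_of_nonneg ha₀, Int.cast_abs]
      calc a * |c| ≤ 1 * |c| := by gcongr
        _ ≤ δ * |(n : ℝ)| + δ / 2 := by rw [one_mul]; exact h1
        _ = (|(n : ℝ)| + 1 / 2) * δ := by ring
    obtain ⟨m, hm, hm'⟩ := exists_int_abs_le_and_abs_sub_le (abs_nonneg n) hu
    refine ⟨m, hm, ?_⟩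
    have : a * c - δ * m = δ * (a * c / δ - m) := by
      rw [mul_sub, mul_div_cancel₀ _ hδ.ne']
    rw [this, abs_mul, abs_of_pos hδ]
    calc δ * |a * c / δ - m| ≤ δ * (1 / 2) := mul_le_mul_of_nonneg_left hm' hδ.le
      _ = δ / 2 := by ring
  obtain ⟨m₀, hm₀, hm₀'⟩ := key z.re (x 0) hzre
  obtain ⟨m₁, hm₁, hm₁'⟩ := key z.im (x 1) hzim
  refine ⟨![m₀, m₁], hΛ x hx _ ?_, mem_meshCell_iff.2 ⟨?_, ?_⟩⟩
  · intro j
    fin_cases j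
    · simpa using hm₀
    · simpa using hm₁
  · simpa [Complex.real_smul] using hm₀'
  · simpa [Complex.real_smul] using hm₁'

/-- The interior of a set star-shaped about `0` and containing `0` in its interior is star-shaped
about `0` (homotheties of ratio `a ∈ (0, 1]` are homeomorphisms mapping the set into itself).
[folklore] -/
theorem starConvex_interior {U : Set ℂ} (hU : StarConvex ℝ (0 : ℂ) U) (h0 : (0 : ℂ) ∈ interior U) :
    StarConvex ℝ (0 : ℂ) (interior U) := by
  rw [starConvex_zero_iff]
  intro z hz a ha₀ ha₁
  rcases eq_or_lt_of_le ha₀ with h | h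
  · subst h; simpa using h0
  · have h1 : a • z ∈ interior (a • U) := by
      rw [interior_smul₀ h.ne']
      exact smul_mem_smul_set hz
    refine interior_mono ?_ h1
    rintro w ⟨u, hu, rfl⟩
    exact hU.smul_mem hu ha₀ ha₁

/-! ### The discretised unit disc -/

namespace UnitDisc

/-- The squared norm of a mesh point in coordinates. [folklore] -/
theorem norm_meshPoint_sq (δ : ℝ) (v : Site 2) :
    ‖meshPoint δ v‖ ^ 2 = δ ^ 2 * (((v 0 : ℤ) : ℝ) ^ 2 + ((v 1 : ℤ) : ℝ) ^ 2) := by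
  rw [Complex.sq_norm, Complex.normSq_apply, meshPoint_re, meshPoint_im]
  ring

/-- `‖δv‖ < 1` in coordinates. [folklore] -/
theorem norm_meshPoint_lt_one_iff {δ : ℝ} {v : Site 2} :
    ‖meshPoint δ v‖ < 1 ↔ δ ^ 2 * (((v 0 : ℤ) : ℝ) ^ 2 + ((v 1 : ℤ) : ℝ) ^ 2) < 1 := by
  rw [← norm_meshPoint_sq, sq_lt_one_iff₀ (norm_nonneg _)]

/-- The mesh vertices of the unit disc are the sites `v` with `‖δv‖ < 1`. [folklore] -/
theorem mem_meshVertices_ball {δ : ℝ} {v : Site 2} :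
    v ∈ meshVertices (ball (0 : ℂ) 1) δ ↔ ‖meshPoint δ v‖ < 1 := by
  rw [Literature.Probability.LatticeModels.mem_meshVertices_iff, mem_ball_zero_iff]

/-- Two `ℤ²`-neighbours of the disc are joined in its mesh graph (the closed disc is convex).
[folklore] -/
theorem meshGraph_adj_of_zdGraph_adj {δ : ℝ} {u v : Site 2} (hu : ‖meshPoint δ u‖ < 1)
    (hv : ‖meshPoint δ v‖ < 1) (h : (zdGraph 2).Adj u v) : (meshGraph (ball (0 : ℂ) 1) δ).Adj u v := by
  refine meshGraph_adj_iff.2 ⟨h, ?_⟩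
  rw [closure_ball (0 : ℂ) one_ne_zero]
  exact (convex_closedBall (0 : ℂ) 1).segment_subset
    (ball_subset_closedBall (mem_ball_zero_iff.2 hu)) (ball_subset_closedBall (mem_ball_zero_iff.2 hv))

/-- A site with coordinates no larger in absolute value than those of a site of the disc is a site
of the disc. [folklore] -/
theorem norm_meshPoint_lt_one_of_abs_le {δ : ℝ} {u v : Site 2} (hu : ‖meshPoint δ u‖ < 1)
    (h : ∀ j, |v j| ≤ |u j|) : ‖meshPoint δ v‖ < 1 := by
  rw [norm_meshPoint_lt_one_iff] at hu ⊢
  have h0' : |((v 0 : ℤ) : ℝ)| ≤ |((u 0 : ℤ) : ℝ)| := by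
    rw [← Int.cast_abs, ← Int.cast_abs]; exact_mod_cast h 0
  have h1' : |((v 1 : ℤ) : ℝ)| ≤ |((u 1 : ℤ) : ℝ)| := by
    rw [← Int.cast_abs, ← Int.cast_abs]; exact_mod_cast h 1
  have h0 : ((v 0 : ℤ) : ℝ) ^ 2 ≤ ((u 0 : ℤ) : ℝ) ^ 2 := sq_le_sq.2 h0'
  have h1 : ((v 1 : ℤ) : ℝ) ^ 2 ≤ ((u 1 : ℤ) : ℝ) ^ 2 := sq_le_sq.2 h1'
  nlinarith [sq_nonneg δ]

/-- The origin is a mesh vertex of the disc. [folklore] -/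
theorem zero_mem_meshVertices (δ : ℝ) : (0 : Site 2) ∈ meshVertices (ball (0 : ℂ) 1) δ := by
  rw [mem_meshVertices_ball, norm_meshPoint_lt_one_iff]; norm_num

/-- Every mesh vertex of the disc is joined to the origin inside the mesh vertex graph (monotone
lattice path towards `0`; the argument of `SupercriticalSAW.meshDomain_unitDisk` in
`Literature/Barriers/CriticalPhenomena/SupercriticalSAWSpaceFillingSteps.lean`, re-proved for
`Metric.ball 0 1` so as not to import the SAW barrier files here). [folklore] -/
theorem reachable_zero {δ : ℝ} (v : Site 2) (hv : v ∈ meshVertices (ball (0 : ℂ) 1) δ) :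
    (meshVertexGraph (ball (0 : ℂ) 1) δ).Reachable ⟨v, hv⟩ ⟨0, zero_mem_meshVertices δ⟩ := by
  suffices key : ∀ n : ℕ, ∀ (v : Site 2) (hv : v ∈ meshVertices (ball (0 : ℂ) 1) δ),
      ∑ j, (v j).natAbs = n →
      (meshVertexGraph (ball (0 : ℂ) 1) δ).Reachable ⟨v, hv⟩ ⟨0, zero_mem_meshVertices δ⟩ from
    key _ v hv rfl
  intro n
  induction n with
  | zero =>
    intro v hv hn
    have : v = 0 := by
      funext i
      exact Int.natAbs_eq_zero.1 (Finset.sum_eq_zero_iff.1 hn i (Finset.mem_univ i))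
    subst this
    rfl
  | succ n ih =>
    intro v hv hn
    obtain ⟨i, hi⟩ : ∃ i : Fin 2, v i ≠ 0 := by
      by_contra hcon
      push Not at hcon
      have : ∑ j, (v j).natAbs = 0 := Finset.sum_eq_zero fun j _ => by simp [hcon j]
      omega
    -- one step towards the origin in the `i`-th coordinate
    obtain ⟨w, hadj, habs, hwj⟩ : ∃ w : Site 2, (zdGraph 2).Adj v w ∧
        (w i).natAbs + 1 = (v i).natAbs ∧ ∀ j, j ≠ i → w j = v j := by
      rcases lt_or_gt_of_ne hi with hneg | hpos
      · refine ⟨v + Pi.single i 1, (zdGraph_adj_iff _ _).2 ⟨i, Or.inl rfl⟩, ?_,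
          fun j hj => by simp [hj]⟩
        simp only [Pi.add_apply, Pi.single_eq_same]
        omega
      · refine ⟨v - Pi.single i 1, (zdGraph_adj_iff _ _).2 ⟨i, Or.inr (by simp)⟩, ?_,
          fun j hj => by simp [hj]⟩
        simp only [Pi.sub_apply, Pi.single_eq_same]
        omega
    have hle : ∀ j, |w j| ≤ |v j| := by
      intro j
      by_cases hj : j = i
      · subst hj
        have h1 : ((w j).natAbs : ℤ) ≤ (v j).natAbs := by omega
        simpa [Int.natCast_natAbs] using h1
      · rw [hwj j hj]
    have hwmem : w ∈ meshVertices (ball (0 : ℂ) 1) δ :=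
      mem_meshVertices_ball.2 (norm_meshPoint_lt_one_of_abs_le (mem_meshVertices_ball.1 hv) hle)
    have hn' : ∑ j, (w j).natAbs = n := by
      have hsum : ∑ j, (w j).natAbs + 1 = ∑ j, (v j).natAbs := by
        rw [Fin.sum_univ_two, Fin.sum_univ_two]
        fin_cases i
        · have h1 := hwj 1 (by decide)
          simp only [Fin.zero_eta] at habs
          rw [h1]; omega
        · have h0 := hwj 0 (by decide)
          simp only [Fin.mk_one] at habs
          rw [h0]; omega
      omega
    have hadj' : (meshVertexGraph (ball (0 : ℂ) 1) δ).Adj ⟨v, hv⟩ ⟨w, hwmem⟩ :=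
      SimpleGraph.induce_adj.2
        (meshGraph_adj_of_zdGraph_adj (mem_meshVertices_ball.1 hv) (mem_meshVertices_ball.1 hwmem) hadj)
    exact hadj'.reachable.trans (ih w hwmem hn')

/-- The mesh vertex graph of the disc is preconnected. [folklore] -/
theorem preconnected (δ : ℝ) : (meshVertexGraph (ball (0 : ℂ) 1) δ).Preconnected := fun u v =>
  (reachable_zero u.1 u.2).trans (reachable_zero v.1 v.2).symm

/-- For the unit disc the discrete domain `𝔻_δ` ("the largest connected component") is all of
`𝔻 ∩ δℤ²`. [folklore] -/
theorem meshDomain_eq (δ : ℝ) : meshDomain (ball (0 : ℂ) 1) δ = meshVertices (ball (0 : ℂ) 1) δ := by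
  refine Subset.antisymm (meshDomain_subset_meshVertices _ _) fun v hv => ?_
  have hsub := (preconnected δ).subsingleton_connectedComponent
  simp only [meshDomain, mem_iUnion, mem_image]
  refine ⟨(meshVertexGraph (ball (0 : ℂ) 1) δ).connectedComponentMk ⟨v, hv⟩, fun C' => ?_, ⟨v, hv⟩,
    ?_, rfl⟩
  · rw [Subsingleton.elim C' ((meshVertexGraph (ball (0 : ℂ) 1) δ).connectedComponentMk ⟨v, hv⟩)]
  · rw [SimpleGraph.ConnectedComponent.mem_supp_iff]

/-- Membership in `𝔻_δ`: `‖δv‖ < 1`. [folklore] -/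
theorem mem_meshDomain_ball {δ : ℝ} {v : Site 2} : v ∈ meshDomain (ball (0 : ℂ) 1) δ ↔ ‖meshPoint δ v‖ < 1 := by
  rw [meshDomain_eq, mem_meshVertices_ball]

/-- The graph `𝔻_δ` is `ℤ²` restricted to the sites of the disc. [folklore] -/
theorem adj_iff {δ : ℝ} {u v : Site 2} :
    (discreteDomainGraph (ball (0 : ℂ) 1) δ).Adj u v ↔
      (zdGraph 2).Adj u v ∧ ‖meshPoint δ u‖ < 1 ∧ ‖meshPoint δ v‖ < 1 := by
  rw [Literature.Probability.LatticeModels.discreteDomainGraph_adj_iff, mem_meshDomain_ball,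
    mem_meshDomain_ball]
  constructor
  · rintro ⟨h, hu, hv⟩
    exact ⟨meshGraph_le_zdGraph _ _ h, hu, hv⟩
  · rintro ⟨h, hu, hv⟩
    exact ⟨meshGraph_adj_of_zdGraph_adj hu hv h, hu, hv⟩

/-- **The free sites of the disc.** For `δ > 0`, a site carries an unfrozen spin of the `+` measure
in the discretised unit disc (`x ∈ meshInteriorFinset 𝔻 δ = 𝔻_δ ∖ ∂𝔻_δ`) iff `δx` and its four
`ℤ²`-neighbours lie in the open disc. [folklore] -/
theorem mem_meshInteriorFinset_iff {δ : ℝ} (hδ : 0 < δ) {x : Site 2} :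
    x ∈ meshInteriorFinset (ball (0 : ℂ) 1) δ ↔
      ‖meshPoint δ x‖ < 1 ∧ ∀ y, (zdGraph 2).Adj x y → ‖meshPoint δ y‖ < 1 := by
  rw [← Finset.mem_coe, coe_meshInteriorFinset isBounded_ball hδ, Set.mem_sdiff, mem_meshDomain_ball,
    mem_meshBoundary_iff, mem_meshDomain_ball]
  constructor
  · rintro ⟨hx, hnb⟩
    refine ⟨hx, fun y hy => ?_⟩
    by_contra hy'
    exact hnb ⟨hx, y, hy, fun hadj => hy' (adj_iff.1 hadj).2.2⟩
  · rintro ⟨hx, hall⟩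
    refine ⟨hx, ?_⟩
    rintro ⟨-, y, hy, hnadj⟩
    exact hnadj (adj_iff.2 ⟨hy, hx, hall y hy⟩)

/-- The free sites in coordinates: `δ²((|x₀| + 1)² + x₁²) < 1` and `δ²(x₀² + (|x₁| + 1)²) < 1`
(the farthest neighbours in each direction). [folklore] -/
theorem free_iff_sq {δ : ℝ} {x : Site 2} :
    (‖meshPoint δ x‖ < 1 ∧ ∀ y, (zdGraph 2).Adj x y → ‖meshPoint δ y‖ < 1) ↔
      δ ^ 2 * ((|((x 0 : ℤ) : ℝ)| + 1) ^ 2 + ((x 1 : ℤ) : ℝ) ^ 2) < 1 ∧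
        δ ^ 2 * (((x 0 : ℤ) : ℝ) ^ 2 + (|((x 1 : ℤ) : ℝ)| + 1) ^ 2) < 1 := by
  constructor
  · rintro ⟨-, hall⟩
    constructor
    · rcases le_or_gt 0 (x 0) with h0 | h0
      · have h := norm_meshPoint_lt_one_iff.1 (hall (x + Pi.single 0 1) ((zdGraph_adj_iff _ _).2 ⟨0, Or.inl rfl⟩))
        have e0 : (((x + Pi.single 0 1 : Site 2) 0 : ℤ) : ℝ) = (x 0 : ℝ) + 1 := by simp
        have e1 : (((x + Pi.single 0 1 : Site 2) 1 : ℤ) : ℝ) = (x 1 : ℝ) := by simp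
        rw [e0, e1] at h
        have h0' : (0 : ℝ) ≤ (x 0 : ℝ) := by exact_mod_cast h0
        rwa [abs_of_nonneg h0']
      · have h := norm_meshPoint_lt_one_iff.1 (hall (x - Pi.single 0 1) ((zdGraph_adj_iff _ _).2 ⟨0, Or.inr (by simp)⟩))
        have e0 : (((x - Pi.single 0 1 : Site 2) 0 : ℤ) : ℝ) = (x 0 : ℝ) - 1 := by simp
        have e1 : (((x - Pi.single 0 1 : Site 2) 1 : ℤ) : ℝ) = (x 1 : ℝ) := by simp
        rw [e0, e1] at h
        have h0' : ((x 0 : ℤ) : ℝ) < 0 := by exact_mod_cast h0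
        rw [abs_of_neg h0']
        have e : (-((x 0 : ℤ) : ℝ) + 1) ^ 2 = (((x 0 : ℤ) : ℝ) - 1) ^ 2 := by ring
        rw [e]; exact h
    · rcases le_or_gt 0 (x 1) with h1 | h1
      · have h := norm_meshPoint_lt_one_iff.1 (hall (x + Pi.single 1 1) ((zdGraph_adj_iff _ _).2 ⟨1, Or.inl rfl⟩))
        have e0 : (((x + Pi.single 1 1 : Site 2) 0 : ℤ) : ℝ) = (x 0 : ℝ) := by simp
        have e1 : (((x + Pi.single 1 1 : Site 2) 1 : ℤ) : ℝ) = (x 1 : ℝ) + 1 := by simp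
        rw [e0, e1] at h
        have h1' : (0 : ℝ) ≤ (x 1 : ℝ) := by exact_mod_cast h1
        rwa [abs_of_nonneg h1']
      · have h := norm_meshPoint_lt_one_iff.1 (hall (x - Pi.single 1 1) ((zdGraph_adj_iff _ _).2 ⟨1, Or.inr (by simp)⟩))
        have e0 : (((x - Pi.single 1 1 : Site 2) 0 : ℤ) : ℝ) = (x 0 : ℝ) := by simp
        have e1 : (((x - Pi.single 1 1 : Site 2) 1 : ℤ) : ℝ) = (x 1 : ℝ) - 1 := by simp
        rw [e0, e1] at h
        have h1' : ((x 1 : ℤ) : ℝ) < 0 := by exact_mod_cast h1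
        rw [abs_of_neg h1']
        have e : (-((x 1 : ℤ) : ℝ) + 1) ^ 2 = (((x 1 : ℤ) : ℝ) - 1) ^ 2 := by ring
        rw [e]; exact h
  · rintro ⟨h0, h1⟩
    have ha0 := abs_nonneg ((x 0 : ℤ) : ℝ)
    have ha1 := abs_nonneg ((x 1 : ℤ) : ℝ)
    have hs0 := sq_abs ((x 0 : ℤ) : ℝ)
    have hs1 := sq_abs ((x 1 : ℤ) : ℝ)
    refine ⟨norm_meshPoint_lt_one_iff.2 (by nlinarith [sq_nonneg δ]), fun y hy => ?_⟩
    rw [norm_meshPoint_lt_one_iff]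
    obtain ⟨i, h | h⟩ := (zdGraph_adj_iff x y).1 hy
    · subst h
      fin_cases i
      · have e0 : (((x + Pi.single 0 1 : Site 2) 0 : ℤ) : ℝ) = (x 0 : ℝ) + 1 := by simp
        have e1 : (((x + Pi.single 0 1 : Site 2) 1 : ℤ) : ℝ) = (x 1 : ℝ) := by simp
        simp only [Fin.zero_eta]
        rw [e0, e1]
        nlinarith [le_abs_self ((x 0 : ℤ) : ℝ), sq_nonneg δ]
      · have e0 : (((x + Pi.single 1 1 : Site 2) 0 : ℤ) : ℝ) = (x 0 : ℝ) := by simp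
        have e1 : (((x + Pi.single 1 1 : Site 2) 1 : ℤ) : ℝ) = (x 1 : ℝ) + 1 := by simp
        simp only [Fin.mk_one]
        rw [e0, e1]
        nlinarith [le_abs_self ((x 1 : ℤ) : ℝ), sq_nonneg δ]
    · -- `x = y + eᵢ`, i.e. `y = x - eᵢ`
      have hy' : y = x - Pi.single i 1 := by rw [h]; simp
      subst hy'
      fin_cases i
      · have e0 : (((x - Pi.single 0 1 : Site 2) 0 : ℤ) : ℝ) = (x 0 : ℝ) - 1 := by simp
        have e1 : (((x - Pi.single 0 1 : Site 2) 1 : ℤ) : ℝ) = (x 1 : ℝ) := by simp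
        simp only [Fin.zero_eta]
        rw [e0, e1]
        nlinarith [neg_abs_le ((x 0 : ℤ) : ℝ), sq_nonneg δ]
      · have e0 : (((x - Pi.single 1 1 : Site 2) 0 : ℤ) : ℝ) = (x 0 : ℝ) := by simp
        have e1 : (((x - Pi.single 1 1 : Site 2) 1 : ℤ) : ℝ) = (x 1 : ℝ) - 1 := by simp
        simp only [Fin.mk_one]
        rw [e0, e1]
        nlinarith [neg_abs_le ((x 1 : ℤ) : ℝ), sq_nonneg δ]

/-- **The free sites form an order ideal**: if `x` is free and `|x'ⱼ| ≤ |xⱼ|` for `j = 0, 1`, then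
`x'` is free. [folklore] -/
theorem free_of_abs_le {δ : ℝ} {x x' : Site 2}
    (hx : ‖meshPoint δ x‖ < 1 ∧ ∀ y, (zdGraph 2).Adj x y → ‖meshPoint δ y‖ < 1)
    (h : ∀ j, |x' j| ≤ |x j|) :
    ‖meshPoint δ x'‖ < 1 ∧ ∀ y, (zdGraph 2).Adj x' y → ‖meshPoint δ y‖ < 1 := by
  rw [free_iff_sq] at hx ⊢
  have h0 : |((x' 0 : ℤ) : ℝ)| ≤ |((x 0 : ℤ) : ℝ)| := by
    rw [← Int.cast_abs, ← Int.cast_abs]; exact_mod_cast h 0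
  have h1 : |((x' 1 : ℤ) : ℝ)| ≤ |((x 1 : ℤ) : ℝ)| := by
    rw [← Int.cast_abs, ← Int.cast_abs]; exact_mod_cast h 1
  have hq0 : ((x' 0 : ℤ) : ℝ) ^ 2 ≤ ((x 0 : ℤ) : ℝ) ^ 2 := sq_le_sq.2 h0
  have hq1 : ((x' 1 : ℤ) : ℝ) ^ 2 ≤ ((x 1 : ℤ) : ℝ) ^ 2 := sq_le_sq.2 h1
  have ha0 := abs_nonneg ((x' 0 : ℤ) : ℝ)
  have ha1 := abs_nonneg ((x' 1 : ℤ) : ℝ)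
  have hp0 : (|((x' 0 : ℤ) : ℝ)| + 1) ^ 2 ≤ (|((x 0 : ℤ) : ℝ)| + 1) ^ 2 := by gcongr
  have hp1 : (|((x' 1 : ℤ) : ℝ)| + 1) ^ 2 ≤ (|((x 1 : ℤ) : ℝ)| + 1) ^ 2 := by gcongr
  have hδ := sq_nonneg δ
  constructor
  · calc δ ^ 2 * ((|((x' 0 : ℤ) : ℝ)| + 1) ^ 2 + ((x' 1 : ℤ) : ℝ) ^ 2)
        ≤ δ ^ 2 * ((|((x 0 : ℤ) : ℝ)| + 1) ^ 2 + ((x 1 : ℤ) : ℝ) ^ 2) := by gcongr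
      _ < 1 := hx.1
  · calc δ ^ 2 * (((x' 0 : ℤ) : ℝ) ^ 2 + (|((x' 1 : ℤ) : ℝ)| + 1) ^ 2)
        ≤ δ ^ 2 * (((x 0 : ℤ) : ℝ) ^ 2 + (|((x 1 : ℤ) : ℝ)| + 1) ^ 2) := by gcongr
      _ < 1 := hx.2

/-- The cell of a free site lies in the open unit disc. [folklore] -/
theorem norm_lt_one_of_mem_meshCell {δ : ℝ} (hδ : 0 < δ) {x : Site 2}
    (hx : ‖meshPoint δ x‖ < 1 ∧ ∀ y, (zdGraph 2).Adj x y → ‖meshPoint δ y‖ < 1) {z : ℂ}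
    (hz : z ∈ meshCell δ x) : ‖z‖ < 1 := by
  rw [free_iff_sq] at hx
  obtain ⟨h0, h1⟩ := hx
  obtain ⟨hre, him⟩ := mem_meshCell_iff.1 hz
  have hre' : |z.re| ≤ δ * |((x 0 : ℤ) : ℝ)| + δ / 2 := by
    calc |z.re| = |(z.re - δ * x 0) + δ * x 0| := by ring_nf
      _ ≤ |z.re - δ * x 0| + |δ * ((x 0 : ℤ) : ℝ)| := abs_add_le _ _
      _ ≤ δ / 2 + δ * |((x 0 : ℤ) : ℝ)| := by rw [abs_mul, abs_of_pos hδ]; linarith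
      _ = _ := by ring
  have him' : |z.im| ≤ δ * |((x 1 : ℤ) : ℝ)| + δ / 2 := by
    calc |z.im| = |(z.im - δ * x 1) + δ * x 1| := by ring_nf
      _ ≤ |z.im - δ * x 1| + |δ * ((x 1 : ℤ) : ℝ)| := abs_add_le _ _
      _ ≤ δ / 2 + δ * |((x 1 : ℤ) : ℝ)| := by rw [abs_mul, abs_of_pos hδ]; linarith
      _ = _ := by ring
  have hsq : ‖z‖ ^ 2 = z.re ^ 2 + z.im ^ 2 := by rw [Complex.sq_norm, Complex.normSq_apply]; ring
  have hre2 : z.re ^ 2 ≤ (δ * |((x 0 : ℤ) : ℝ)| + δ / 2) ^ 2 := by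
    rw [← sq_abs z.re]; exact pow_le_pow_left₀ (abs_nonneg _) hre' 2
  have him2 : z.im ^ 2 ≤ (δ * |((x 1 : ℤ) : ℝ)| + δ / 2) ^ 2 := by
    rw [← sq_abs z.im]; exact pow_le_pow_left₀ (abs_nonneg _) him' 2
  have ha0 := abs_nonneg ((x 0 : ℤ) : ℝ)
  have ha1 := abs_nonneg ((x 1 : ℤ) : ℝ)
  have hs0 := sq_abs ((x 0 : ℤ) : ℝ)
  have hs1 := sq_abs ((x 1 : ℤ) : ℝ)
  have hlt : ‖z‖ ^ 2 < 1 := by nlinarith [sq_nonneg δ]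
  exact (sq_lt_one_iff₀ (norm_nonneg z)).1 hlt

/-- Mesh points of `ℤ²`-neighbours are at distance `|δ|`. [folklore] -/
theorem norm_meshPoint_sub_of_adj (δ : ℝ) {x y : Site 2} (h : (zdGraph 2).Adj x y) :
    ‖meshPoint δ y - meshPoint δ x‖ = |δ| := by
  have key : ∀ (u : Site 2) (i : Fin 2), ‖meshPoint δ (u + Pi.single i 1) - meshPoint δ u‖ = |δ| := by
    intro u i
    have hre : (meshPoint δ (u + Pi.single i 1) - meshPoint δ u).re =
        δ * ((Pi.single i (1 : ℤ) : Site 2) 0 : ℤ) := by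
      simp only [Complex.sub_re, meshPoint_re, Pi.add_apply, Int.cast_add]; ring
    have him : (meshPoint δ (u + Pi.single i 1) - meshPoint δ u).im =
        δ * ((Pi.single i (1 : ℤ) : Site 2) 1 : ℤ) := by
      simp only [Complex.sub_im, meshPoint_im, Pi.add_apply, Int.cast_add]; ring
    have hsq : ‖meshPoint δ (u + Pi.single i 1) - meshPoint δ u‖ ^ 2 = δ ^ 2 := by
      rw [Complex.sq_norm, Complex.normSq_apply, hre, him]
      fin_cases i <;> simp [sq]
    have h1 : ‖meshPoint δ (u + Pi.single i 1) - meshPoint δ u‖ = Real.sqrt (δ ^ 2) := by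
      rw [← hsq, Real.sqrt_sq (norm_nonneg _)]
    rw [h1, Real.sqrt_sq_eq_abs]
  obtain ⟨i, h | h⟩ := (zdGraph_adj_iff x y).1 h
  · rw [h]; exact key x i
  · rw [h, ← norm_neg, neg_sub]; exact key y i

/-- **Covering lemma.** For `δ > 0`, every point `z` with `‖z‖ + 5δ/2 ≤ 1` lies in the polygonal
domain `P_δ = meshInteriorPolygon 𝔻 δ` of the free sites: the ball `B(z, δ/2)` is covered by cells
of free sites (the cell of the site nearest to `w ∈ B(z, δ/2)`, whose neighbours are within
`‖z‖ + 5δ/2` of the origin). [folklore] -/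
theorem mem_meshInteriorPolygon_of_norm_le {δ : ℝ} (hδ : 0 < δ) {z : ℂ} (hz : ‖z‖ + 5 / 2 * δ ≤ 1) :
    z ∈ meshInteriorPolygon (ball (0 : ℂ) 1) δ := by
  unfold meshInteriorPolygon meshPolygon
  refine mem_interior_iff_mem_nhds.2 (mem_of_superset (ball_mem_nhds z (half_pos hδ)) ?_)
  intro w hw
  rw [mem_ball, dist_eq_norm] at hw
  simp only [mem_iUnion, Finset.mem_coe, exists_prop]
  refine ⟨nearestSite δ w, (mem_meshInteriorFinset_iff hδ).2 ?_, mem_meshCell_nearestSite hδ w⟩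
  have hw' : ‖w‖ < ‖z‖ + δ / 2 := by
    calc ‖w‖ = ‖z + (w - z)‖ := by ring_nf
      _ ≤ ‖z‖ + ‖w - z‖ := norm_add_le _ _
      _ < ‖z‖ + δ / 2 := by linarith
  have hx : ‖meshPoint δ (nearestSite δ w)‖ ≤ ‖w‖ + δ := by
    have hd := dist_meshPoint_nearestSite_le hδ w
    rw [dist_eq_norm] at hd
    calc ‖meshPoint δ (nearestSite δ w)‖ = ‖w + (meshPoint δ (nearestSite δ w) - w)‖ := by ring_nf
      _ ≤ ‖w‖ + ‖meshPoint δ (nearestSite δ w) - w‖ := norm_add_le _ _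
      _ ≤ ‖w‖ + δ := by linarith
  refine ⟨by linarith, fun y hy => ?_⟩
  have hδy := norm_meshPoint_sub_of_adj δ hy
  rw [abs_of_pos hδ] at hδy
  calc ‖meshPoint δ y‖ = ‖meshPoint δ (nearestSite δ w) + (meshPoint δ y - meshPoint δ (nearestSite δ w))‖ := by
        ring_nf
    _ ≤ ‖meshPoint δ (nearestSite δ w)‖ + ‖meshPoint δ y - meshPoint δ (nearestSite δ w)‖ := norm_add_le _ _
    _ = ‖meshPoint δ (nearestSite δ w)‖ + δ := by rw [hδy]
    _ < 1 := by linarith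

/-- The union of the cells of the free sites is closed (finitely many closed cells). [folklore] -/
theorem isClosed_biUnion_meshCell (δ : ℝ) :
    IsClosed (⋃ x ∈ (meshInteriorFinset (ball (0 : ℂ) 1) δ : Set (Site 2)), meshCell δ x) :=
  (meshInteriorFinset (ball (0 : ℂ) 1) δ).finite_toSet.isClosed_biUnion fun x _ => isClosed_meshCell δ x

/-- The union of the cells of the free sites lies in the open unit disc (`δ > 0`). [folklore] -/
theorem biUnion_meshCell_subset_ball {δ : ℝ} (hδ : 0 < δ) :
    (⋃ x ∈ (meshInteriorFinset (ball (0 : ℂ) 1) δ : Set (Site 2)), meshCell δ x) ⊆ ball (0 : ℂ) 1 := by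
  intro z hz
  simp only [mem_iUnion, Finset.mem_coe, exists_prop] at hz
  obtain ⟨x, hx, hzx⟩ := hz
  exact mem_ball_zero_iff.2 (norm_lt_one_of_mem_meshCell hδ ((mem_meshInteriorFinset_iff hδ).1 hx) hzx)

/-- The polygonal domain of the free sites lies in the open unit disc (`δ > 0`). [folklore] -/
theorem meshInteriorPolygon_subset_ball {δ : ℝ} (hδ : 0 < δ) :
    meshInteriorPolygon (ball (0 : ℂ) 1) δ ⊆ ball (0 : ℂ) 1 :=
  interior_subset.trans (biUnion_meshCell_subset_ball hδ)

/-- Its closure lies in the union of the cells, hence in the open unit disc. [folklore] -/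
theorem closure_meshInteriorPolygon_subset_ball {δ : ℝ} (hδ : 0 < δ) :
    closure (meshInteriorPolygon (ball (0 : ℂ) 1) δ) ⊆ ball (0 : ℂ) 1 :=
  ((closure_mono interior_subset).trans (isClosed_biUnion_meshCell δ).closure_subset).trans
    (biUnion_meshCell_subset_ball hδ)

/-- **The discrete boundary lies in a thin annulus**: a point of `∂P_δ` has
`1 - 5δ/2 < ‖z‖ < 1`. [folklore] -/
theorem norm_of_mem_frontier {δ : ℝ} (hδ : 0 < δ) {z : ℂ}
    (hz : z ∈ frontier (meshInteriorPolygon (ball (0 : ℂ) 1) δ)) : 1 - 5 / 2 * δ < ‖z‖ ∧ ‖z‖ < 1 := by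
  have hPo : IsOpen (meshInteriorPolygon (ball (0 : ℂ) 1) δ) := isOpen_meshPolygon _ _
  rw [hPo.frontier_eq] at hz
  refine ⟨?_, mem_ball_zero_iff.1 (closure_meshInteriorPolygon_subset_ball hδ hz.1)⟩
  by_contra h
  push Not at h
  exact hz.2 (mem_meshInteriorPolygon_of_norm_le hδ (by linarith))

/-- **The polygonal domain of the discretised disc is star-shaped about the origin** (for
`0 < δ < 1`): the free sites form an order ideal, so the union of their cells is star-shaped, and
so is its interior, which contains `0`. [folklore] -/
theorem starConvex_meshInteriorPolygon {δ : ℝ} (hδ : 0 < δ) (hδ1 : δ < 2 / 5) :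
    StarConvex ℝ (0 : ℂ) (meshInteriorPolygon (ball (0 : ℂ) 1) δ) := by
  unfold meshInteriorPolygon meshPolygon
  refine starConvex_interior (starConvex_biUnion_meshCell hδ fun x hx x' hx' => ?_) ?_
  · rw [Finset.mem_coe, mem_meshInteriorFinset_iff hδ] at hx ⊢
    exact free_of_abs_le hx hx'
  · exact mem_meshInteriorPolygon_of_norm_le hδ (by simp; linarith)

/-- Hence it is simply connected (for `0 < δ < 2/5`). [folklore] -/
theorem isSimplyConnected_meshInteriorPolygon {δ : ℝ} (hδ : 0 < δ) (hδ1 : δ < 2 / 5) :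
    IsSimplyConnected (meshInteriorPolygon (ball (0 : ℂ) 1) δ) :=
  SlitDisc.isSimplyConnected_of_starConvex (starConvex_meshInteriorPolygon hδ hδ1)
    (mem_meshInteriorPolygon_of_norm_le hδ (by simp; linarith))

/-- **Hausdorff control of the discrete boundary**: for `0 < δ < 2/5`,
`hausdorffDist (∂P_δ) (∂𝔻) ≤ 5δ/2`. Points of `∂P_δ` are radially within `5δ/2` of the circle;
conversely the radius towards a point of the circle starts in `P_δ` (at `0`) and ends outside it,
so it meets `∂P_δ`, necessarily in the annulus `1 - 5δ/2 < ‖z‖`. [folklore] -/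
theorem hausdorffDist_frontier_le {δ : ℝ} (hδ : 0 < δ) (hδ1 : δ < 2 / 5) :
    hausdorffDist (frontier (meshInteriorPolygon (ball (0 : ℂ) 1) δ)) (frontier (ball (0 : ℂ) 1)) ≤
      5 / 2 * δ := by
  set P := meshInteriorPolygon (ball (0 : ℂ) 1) δ with hP
  have hPo : IsOpen P := isOpen_meshPolygon _ _
  rw [frontier_ball (0 : ℂ) one_ne_zero]
  refine hausdorffDist_le_of_mem_dist (by positivity) (fun z hz => ?_) (fun y hy => ?_)
  · -- from `∂P_δ` to the circle: radial projection
    obtain ⟨hz1, hz2⟩ := norm_of_mem_frontier hδ hz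
    have hz0 : 0 < ‖z‖ := by linarith
    have hz0' : z ≠ 0 := norm_pos_iff.1 hz0
    refine ⟨((‖z‖⁻¹ : ℝ) : ℂ) * z, ?_, ?_⟩
    · rw [mem_sphere_zero_iff_norm, norm_mul, Complex.norm_real, Real.norm_eq_abs,
        abs_of_pos (inv_pos.2 hz0), inv_mul_cancel₀ hz0.ne']
    · rw [dist_eq_norm]
      have : z - ((‖z‖⁻¹ : ℝ) : ℂ) * z = ((1 - ‖z‖⁻¹ : ℝ) : ℂ) * z := by push_cast; ring
      rw [this, norm_mul, Complex.norm_real, Real.norm_eq_abs]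
      have h1 : |1 - ‖z‖⁻¹| * ‖z‖ = 1 - ‖z‖ := by
        rw [abs_of_nonpos (by rw [sub_nonpos]; exact one_le_inv_iff₀.2 ⟨hz0, hz2.le⟩), neg_sub,
          sub_mul, inv_mul_cancel₀ hz0.ne', one_mul]
      rw [h1]; linarith
  · -- from the circle to `∂P_δ`: the radius `[0, y]` leaves `P_δ`
    have hy1 : ‖y‖ = 1 := mem_sphere_zero_iff_norm.1 hy
    have h0P : (0 : ℂ) ∈ P := mem_meshInteriorPolygon_of_norm_le hδ (by simp; linarith)
    have hyP : y ∉ P := fun h => by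
      have := mem_ball_zero_iff.1 (meshInteriorPolygon_subset_ball hδ h); linarith
    have hS : IsPreconnected (segment ℝ (0 : ℂ) y) := (convex_segment (0 : ℂ) y).isPreconnected
    have hnot : ¬ (closure P ∩ segment ℝ (0 : ℂ) y ⊆ P) := fun h =>
      hyP (hS.subset_of_closure_inter_subset hPo ⟨0, left_mem_segment ℝ 0 y, h0P⟩ h
        (right_mem_segment ℝ 0 y))
    obtain ⟨q, ⟨hqc, hqS⟩, hqP⟩ := not_subset.1 hnot
    have hqf : q ∈ frontier P := by rw [hPo.frontier_eq]; exact ⟨hqc, hqP⟩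
    refine ⟨q, hqf, ?_⟩
    obtain ⟨hq1, -⟩ := norm_of_mem_frontier hδ hqf
    rw [segment_eq_image ℝ (0 : ℂ) y] at hqS
    obtain ⟨θ, ⟨hθ0, hθ1⟩, rfl⟩ := hqS
    simp only [smul_zero, zero_add] at hq1 ⊢
    rw [norm_smul, Real.norm_eq_abs, abs_of_nonneg hθ0, hy1, mul_one] at hq1
    rw [dist_eq_norm]
    have : y - θ • y = (1 - θ) • y := by rw [sub_smul, one_smul]
    rw [this, norm_smul, Real.norm_eq_abs, abs_of_nonneg (by linarith), hy1, mul_one]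
    linarith

end UnitDisc

/-! ### The unit disc satisfies `MeshApproximates` -/

/-- **The discretised unit disc approximates the unit disc in CHI's sense**: as `δ → 0⁺`, the
polygonal domain `P_δ` of the free sites of `𝔻_δ` is (eventually) simply connected, `∂P_δ → ∂𝔻`
in Hausdorff distance (indeed `hausdorffDist ≤ 5δ/2`), and every compact `K ⊆ 𝔻` is eventually
inside `P_δ`. In particular CHI's standing hypothesis `MeshApproximates` (arXiv:1202.2838 §2,
p. 13 and §2.1), carried by `chi_halfplane_onePoint_hausdorff`, is satisfiable. [folklore] -/
theorem meshApproximates_ball : MeshApproximates (ball (0 : ℂ) 1) := by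
  have hI : Ioo (0 : ℝ) (2 / 5) ∈ 𝓝[>] (0 : ℝ) := Ioo_mem_nhdsGT (by norm_num)
  refine ⟨?_, ?_, ?_⟩
  · filter_upwards [hI] with δ hδ
    exact UnitDisc.isSimplyConnected_meshInteriorPolygon hδ.1 hδ.2
  · -- `0 ≤ hausdorffDist ≤ 5δ/2 → 0`
    have hg : Tendsto (fun δ : ℝ => 5 / 2 * δ) (𝓝[>] 0) (𝓝 0) := by
      have : Tendsto (fun δ : ℝ => 5 / 2 * δ) (𝓝 0) (𝓝 (5 / 2 * 0)) :=
        tendsto_const_nhds.mul tendsto_id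
      rw [mul_zero] at this
      exact this.mono_left nhdsWithin_le_nhds
    refine squeeze_zero' (Eventually.of_forall fun δ => hausdorffDist_nonneg) ?_ hg
    filter_upwards [hI] with δ hδ
    exact UnitDisc.hausdorffDist_frontier_le hδ.1 hδ.2
  · intro K hK hKΩ
    obtain ⟨r, hr1, hKr⟩ := exists_lt_subset_ball hK.isClosed hKΩ
    have hI' : Ioo (0 : ℝ) (2 / 5 * (1 - r)) ∈ 𝓝[>] (0 : ℝ) := Ioo_mem_nhdsGT (by linarith)
    filter_upwards [hI'] with δ hδ z hz
    have hz' : ‖z‖ < r := mem_ball_zero_iff.1 (hKr hz)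
    exact UnitDisc.mem_meshInteriorPolygon_of_norm_le hδ.1 (by linarith [hδ.2])

/-- **The corrected one-point fact is not vacuous**: under `chi_halfplane_onePoint_hausdorff` the
one-point function of the discretised unit disc is pinned, through the inverse Cayley transform
`w ↦ i(1 + w)/(1 - w)` (a conformal bijection `𝔻 → ℍ`), as
`lim_{δ→0⁺} δ^{-1/8} 𝔼⁺_{𝔻_δ}[σ_a] = 𝒞 · |φ'(a)|^{1/8} (2 Im φ(a))^{-1/8}` for every `a ∈ 𝔻`
(`= 𝒞 (1 - |a|²)^{-1/8}`, CHI's `⟨σ_a⟩⁺_𝔻 ∝ rad(a, 𝔻)^{-1/8}`).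
[cite: ChelkakHonglerIzyurovAnnals2015, Thm. 1.3 (k = 0) with eqs. (1.2)–(1.3), for Ω = 𝔻] -/
theorem chiPlusCorr_ball_of_hausdorff (h : chi_halfplane_onePoint_hausdorff) :
    ∃ C : ℝ, 0 < C ∧ ∀ a ∈ ball (0 : ℂ) 1,
      chiPlusCorr (ball (0 : ℂ) 1) 1 ![a] =
        C * ‖deriv RandomPlanarGeometry.cayleyInvFun a‖ ^ ((1 : ℝ) / 8) *
          (2 * (RandomPlanarGeometry.cayleyInvFun a).im) ^ (-(1 : ℝ) / 8) := by
  obtain ⟨C, hC, H⟩ := h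
  exact ⟨C, hC, fun a ha => H _ _ SlitDisc.isAdmissibleDomain_ball meshApproximates_ball
    SlitDisc.isConformalBijection_cayleyInvFun a ha⟩

/-- The derivative of the inverse Cayley transform `w ↦ i(1 + w)/(1 - w)`:
`(cayley⁻¹)'(w) = 2i/(1 - w)²` for `w ≠ 1`. (Ahlfors, *Complex Analysis*, Ch. 3 §3.) [folklore] -/
theorem hasDerivAt_cayleyInvFun {w : ℂ} (hw : w ≠ 1) :
    HasDerivAt RandomPlanarGeometry.cayleyInvFun (2 * Complex.I / (1 - w) ^ 2) w := by
  have h1 : HasDerivAt (fun w : ℂ => Complex.I * (1 + w)) (Complex.I * 1) w :=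
    ((hasDerivAt_id w).const_add 1).const_mul Complex.I
  have h2 : HasDerivAt (fun w : ℂ => 1 - w) (-1) w := (hasDerivAt_id w).const_sub 1
  have hw' : (fun w : ℂ => 1 - w) w ≠ 0 := sub_ne_zero.2 (Ne.symm hw)
  have h3 : HasDerivAt RandomPlanarGeometry.cayleyInvFun
      ((Complex.I * 1 * ((fun w : ℂ => 1 - w) w) - (fun w : ℂ => Complex.I * (1 + w)) w * (-1)) /
        ((fun w : ℂ => 1 - w) w) ^ 2) w := h1.div h2 hw'
  refine h3.congr_deriv ?_
  simp only
  congr 1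
  ring

/-- **The magnetisation profile of the disc.** Under `chi_halfplane_onePoint_hausdorff`,
`lim_{δ→0⁺} δ^{-1/8} 𝔼⁺_{𝔻_δ}[σ_a] = 𝒞 · (1 - |a|²)^{-1/8}` for every `a ∈ 𝔻`: the transported
half-plane formula evaluated through the inverse Cayley transform (`|φ'(a)| = 2/|1 - a|²`,
`2 Im φ(a) = 2(1 - |a|²)/|1 - a|²`), i.e. CHI's `⟨σ_a⟩⁺_𝔻 = 2^{1/4} rad(a, 𝔻)^{-1/8}` with
`rad(a, 𝔻) = 1 - |a|²`, up to the lattice constant.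
[cite: ChelkakHonglerIzyurovAnnals2015, Thm. 1.3 (k = 0) with eqs. (1.2)–(1.3), for Ω = 𝔻] -/
theorem chiPlusCorr_ball_eq_of_hausdorff (h : chi_halfplane_onePoint_hausdorff) :
    ∃ C : ℝ, 0 < C ∧ ∀ a ∈ ball (0 : ℂ) 1,
      chiPlusCorr (ball (0 : ℂ) 1) 1 ![a] = C * (1 - ‖a‖ ^ 2) ^ (-(1 : ℝ) / 8) := by
  obtain ⟨C, hC, H⟩ := chiPlusCorr_ball_of_hausdorff h
  refine ⟨C, hC, fun a ha => ?_⟩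
  rw [H a ha]
  have ha1 : ‖a‖ < 1 := mem_ball_zero_iff.1 ha
  have hane : a ≠ 1 := by rintro rfl; simp at ha1
  have hn : 0 < ‖1 - a‖ := norm_pos_iff.2 (sub_ne_zero.2 (Ne.symm hane))
  have hd : ‖deriv RandomPlanarGeometry.cayleyInvFun a‖ = 2 / ‖1 - a‖ ^ 2 := by
    rw [(hasDerivAt_cayleyInvFun hane).deriv, norm_div, norm_mul, Complex.norm_I, norm_pow,
      Complex.norm_two, mul_one]
  have hi : 2 * (RandomPlanarGeometry.cayleyInvFun a).im = 2 / ‖1 - a‖ ^ 2 * (1 - ‖a‖ ^ 2) := by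
    rw [RandomPlanarGeometry.cayleyInvFun_im, Complex.normSq_eq_norm_sq, Complex.normSq_eq_norm_sq]
    ring
  rw [hd, hi]
  have hu : 0 < 2 / ‖1 - a‖ ^ 2 := by positivity
  have hv : 0 < 1 - ‖a‖ ^ 2 := by nlinarith [norm_nonneg a]
  rw [Real.mul_rpow hu.le hv.le]
  have key : (2 / ‖1 - a‖ ^ 2) ^ ((1 : ℝ) / 8) * (2 / ‖1 - a‖ ^ 2) ^ (-(1 : ℝ) / 8) = 1 := by
    rw [← Real.rpow_add hu]; norm_num
  calc C * (2 / ‖1 - a‖ ^ 2) ^ ((1 : ℝ) / 8) *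
        ((2 / ‖1 - a‖ ^ 2) ^ (-(1 : ℝ) / 8) * (1 - ‖a‖ ^ 2) ^ (-(1 : ℝ) / 8))
      = C * ((2 / ‖1 - a‖ ^ 2) ^ ((1 : ℝ) / 8) * (2 / ‖1 - a‖ ^ 2) ^ (-(1 : ℝ) / 8)) *
          (1 - ‖a‖ ^ 2) ^ (-(1 : ℝ) / 8) := by ring
    _ = C * (1 - ‖a‖ ^ 2) ^ (-(1 : ℝ) / 8) := by rw [key, mul_one]

end Literature.Probability.LatticeModels
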